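import Summits.HodgeConjecture.CorCM.HypLiu418.RecordSystemAlongConj
import Summits.HodgeConjecture.CorCM.HypLiu418.RecordSystemFrameChange
import HarnessLib

/-!
# Descent WITH THE POINTS EXPOSED, and the points of the re-read record systems (conjugate embedding, other frame)

Cell `hodgecm-mathlib`, fan A, off-place half of `HLiu418` (HANDOFF §7 item (3); A-p08 STATUS 2026-08-28T04:4xZ): the same-models
re-readings ✔ `RecordSystem.exists_alongConj` (B2) and ✔ `RecordSystem.exists_frameChange` return `∃ R', R'.M = R.M` only; the I-4 route of
the off-place transport also needs HOW the new record's `pts` reads the old one's (to intertwine Hecke translates, which are pinned by their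
action on complex points — ✔ `ComplexRecord.hecke_unique`).  This file re-runs ✔ `recordSystem_exists_of_descent`
(`HComp/RecordSystemConjRecip.lean`, construction VERBATIM) as a DEFINITION `RecordSystem.ofDescent` — so that the point formula its
construction has by `rfl` (`(S.pts K)⁻¹ P = (M_K(ℂ) ≃ (M_K)_τ(ℂ))⁻¹ (e_K⁻¹ (Sc.pts_K⁻¹ P))`, `ofDescent_pts_symm`) can be STATED (an `∃ S, S.M = M ∧ …`
cannot even state it: `S.pts` lives on `S.M`, not on `M`) — and packages the two re-readings as definitions with their point formulas:

* `RecordSystem.ofDescent` + `ofDescent_M` (`rfl`) + `ofDescent_pts_symm` (`rfl`);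
* `RecordSystem.alongConj R` (B2 as data) + `alongConj_M : _ = R.M` (`rfl`) + `alongConj_pts_symm_mk` —
  `(R.alongConj.pts K)⁻¹ [x, aK]_{τ̄} = Spec(conj) ≫ (R.pts K)⁻¹ [x̄, aK]` (wb-1's `twist`);
* `RecordSystem.frameChange R u` + `frameChange_M` (`rfl`) + `frameChange_pts_symm_mk` — `(… pts K)⁻¹ [y, aK]_{T·u} = (R.pts K)⁻¹ [u • y, aK]`.

KERNEL: definitions by explicit construction + theorems; no instance, no notation, no named fact, no `sorry`.  HC_CM is NOT proved here; HC_CM is proved only modulo the 7 printed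
citations until rung 0 closes.

References: [Deligne1979ShimuraVarieties] 2.2.4–2.2.5; [Milne2005ShimuraVarieties] Def. 12.8 (62) p. 114, Def. 12.10 p. 115, Lemma 5.13.
-/

set_option autoImplicit false

noncomputable section

open CategoryTheory AlgebraicGeometry NumberField IsDedekindDomain Matrix
open Literature.AlgebraicGeometry.Motives
open Literature.NumberTheory.Automorphic.Liu2021.AppendixC (C5.OpenCompactSubgroup C5.SmallLevel)

namespace Summit.HodgeConjecture.CorCM.Model.RecordSystemConj

section DescentPts

open Function MulAction Topology CategoryTheory.Limits AlgebraicGeometry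
open scoped Matrix ComplexOrder
open Literature.AlgebraicGeometry.ShimuraVarieties Literature.AlgebraicGeometry.ShimuraVarieties.UnitaryCanonicalModel
open Literature.NumberTheory.Automorphic Literature.NumberTheory.Automorphic.UnitaryGroup
open Literature.Geometry.ComplexHyperbolic Literature.Geometry.ComplexHyperbolic.BallModel
open Literature.NumberTheory.Automorphic.ShimuraDissection
open Summit.HodgeConjecture.CorCM.D2Bridge

variable {L : Type} [Field L] [NumberField L] [IsCMField L] {H : Matrix (Fin 3) (Fin 3) L}
  {τ : L →+* ℂ} {T : GL (Fin 3) ℂ} {hT : formCongr (starRingEnd ℂ) T (H.map τ) = BallModel.J}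
  {K₀ : C5.OpenCompactSubgroup ↥(finAdelic (↥(maximalRealSubfield L)) L (IsCMField.complexConj L) 3 H)}

omit [NumberField L] [IsCMField L] in
/-- Naturality of `X_τ(ℂ) → X(ℂ)` (`AlgPoints.baseChangeEquiv`, inverse direction) in the `L`-scheme `X` (private copy, as in
`HComp/RecordSystemConjRecip`). [folklore] -/
private theorem baseChangeEquiv_symm_map₃ {X Y : SchemeOver L} (f : X ⟶ Y)
    (u : ComplexPoints ((Literature.AlgebraicGeometry.Motives.baseChangeHom τ).obj X)) :
    (letI : Algebra L ℂ := τ.toAlgebra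
     (AlgPoints.baseChangeEquiv τ Y).symm (AlgPoints.map ((Literature.AlgebraicGeometry.Motives.baseChangeHom τ).map f) u) =
      AlgPoints.map f ((AlgPoints.baseChangeEquiv τ X).symm u)) := by
  letI : Algebra L ℂ := τ.toAlgebra
  apply Over.OverMorphism.ext
  rw [AlgPoints.baseChangeEquiv_symm_apply_left, AlgPoints.map_apply, Over.comp_left,
    AlgPoints.map_apply, Over.comp_left, AlgPoints.baseChangeEquiv_symm_apply_left]
  simp only [Category.assoc, Literature.AlgebraicGeometry.Motives.baseChangeHom_map_left_comp_fst]
  exact (Category.assoc _ _ _).symm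

set_option maxHeartbeats 1600000 in -- large adelic / Shimura-set terms: instance-heavy statement and transport (as the original)
/-- **The record system of an `L`-descent with reciprocity of a complex record system, AS DATA** — the construction of
✔ `recordSystem_exists_of_descent` (`HComp/RecordSystemConjRecip.lean`; [Deligne1979ShimuraVarieties] 2.2.5) VERBATIM, returned as a definition:
models `M`, points `M_K(ℂ) ≃ (M_K)_τ(ℂ) ≃[e_K] Mc_K(ℂ) ≃[Sc.pts] Sh_K(ℂ)`, `hol`/`pieces` transported along `e⁻¹`, reciprocity = the hypothesis.
[cite: Deligne1979ShimuraVarieties, 2.2.4–2.2.5 (PDF p. 29 of Milne's translation)] [cite: Milne2005ShimuraVarieties, Def. 12.8 (62) p. 114; Def. 12.10 p. 115] -/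
def RecordSystem.ofDescent (Sc : ComplexRecordSystem L H τ T hT K₀)
    (M : C5.SmallLevel K₀ ⥤ SchemeOver L)
    (hsm : ∀ K : C5.SmallLevel K₀, AlgebraicGeometry.SmoothOfRelativeDimension 2 (M.obj K).hom)
    (hpr : ∀ K : C5.SmallLevel K₀, IsProjectiveOver (M.obj K))
    (e : (M ⋙ Literature.AlgebraicGeometry.Motives.baseChangeHom τ) ≅ Sc.Mc)
    (recip : letI : Algebra L ℂ := τ.toAlgebra
      ∀ (K : C5.SmallLevel K₀) (σ : ℂ ≃ₐ[L] ℂ) (s : (FiniteAdeleRing (𝓞 L) L)ˣ),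
        IsArtinCorrespondent L τ s σ.toRingEquiv →
        ∀ (v₃ : Fin 3 → L) (x : Ball), IsLinePoint L τ T v₃ x →
          ∀ d : finAdelic (↥(maximalRealSubfield L)) L (IsCMField.complexConj L) 3 H,
            IsDiagTwist L H v₃ (recipFactor L s) d →
            ∀ a : finAdelic (↥(maximalRealSubfield L)) L (IsCMField.complexConj L) 3 H,
              σ • (AlgPoints.baseChangeEquiv τ (M.obj K)).symm
                  (AlgPoints.map (e.inv.app K) ((Sc.pts K).symm (ShimuraSet.mk L H τ T hT K.1.1 x a))) =
                (AlgPoints.baseChangeEquiv τ (M.obj K)).symm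
                  (AlgPoints.map (e.inv.app K) ((Sc.pts K).symm (ShimuraSet.mk L H τ T hT K.1.1 x (d * a))))) :
    RecordSystem L H τ T hT K₀ := by
  letI : Algebra L ℂ := τ.toAlgebra
  classical
  -- the components of `e`, typed on `(M_K)_τ`
  let eK : ∀ K : C5.SmallLevel K₀, (Literature.AlgebraicGeometry.Motives.baseChangeHom τ).obj (M.obj K) ≅ Sc.Mc.obj K := fun K => e.app K
  have heK_nat : ∀ (K K' : C5.SmallLevel K₀) (f : K ⟶ K'),
      (Literature.AlgebraicGeometry.Motives.baseChangeHom τ).map (M.map f) ≫ (eK K').hom = (eK K).hom ≫ Sc.Mc.map f :=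
    fun K K' f => e.hom.naturality f
  haveI hiso : ∀ K : C5.SmallLevel K₀, IsIso (eK K).inv.left := fun K =>
    (inferInstance : IsIso ((Over.forget _).mapIso (eK K)).inv)
  -- `M_K(ℂ)_{along τ} ≃ₜ (M_K)_τ(ℂ) ≃ₜ Mc_K(ℂ) ≃ₜ Sh_K(ℂ)`
  let b : ∀ K : C5.SmallLevel K₀, ComplexPoints (M.obj K) ≃ₜ ComplexPoints ((Literature.AlgebraicGeometry.Motives.baseChangeHom τ).obj (M.obj K)) :=
    fun K => Homeomorph.mk (AlgPoints.baseChangeEquiv τ (M.obj K)) (AlgPoints.continuous_baseChangeEquiv τ (M.obj K))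
      (AlgPoints.continuous_baseChangeEquiv_symm τ (M.obj K))
  -- the homeomorphism of complex points induced by the isomorphism `eK K` (`AlgPoints.map` both ways)
  let ptsH : ∀ K : C5.SmallLevel K₀, ComplexPoints ((Literature.AlgebraicGeometry.Motives.baseChangeHom τ).obj (M.obj K)) ≃ₜ ComplexPoints (Sc.Mc.obj K) :=
    fun K => Homeomorph.mk ⟨AlgPoints.map (eK K).hom, AlgPoints.map (eK K).inv,
        fun P => by rw [← AlgPoints.map_comp_apply, Iso.hom_inv_id, AlgPoints.map_id]; rfl,
        fun Q => by rw [← AlgPoints.map_comp_apply, Iso.inv_hom_id, AlgPoints.map_id]; rfl⟩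
      (AlgPoints.continuous_map _) (AlgPoints.continuous_map _)
  let pts : ∀ K : C5.SmallLevel K₀, ComplexPoints (M.obj K) ≃ₜ ShimuraSet L H τ T hT K.1.1 :=
    fun K => ((b K).trans (ptsH K)).trans (Sc.pts K)
  have hpts : ∀ (K : C5.SmallLevel K₀) (P : ShimuraSet L H τ T hT K.1.1),
      (pts K).symm P = (AlgPoints.baseChangeEquiv τ (M.obj K)).symm (AlgPoints.map (eK K).inv ((Sc.pts K).symm P)) :=
    fun K P => rfl
  have hpts' : ∀ (K : C5.SmallLevel K₀) (P : ShimuraSet L H τ T hT K.1.1),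
      AlgPoints.baseChangeEquiv τ (M.obj K) ((pts K).symm P) = AlgPoints.map (eK K).inv ((Sc.pts K).symm P) :=
    fun K P => by rw [hpts, Equiv.apply_symm_apply]
  have hinvhom : ∀ (K : C5.SmallLevel K₀) (P : ComplexPoints (Sc.Mc.obj K)),
      AlgPoints.map (eK K).hom (AlgPoints.map (eK K).inv P) = P := fun K P => by
    rw [← AlgPoints.map_comp_apply, Iso.inv_hom_id, AlgPoints.map_id]; rfl
  refine { M := M, smooth := hsm, projective := hpr, pts := pts, map_pts := ?_, hol := ?_, pieces := ?_, recip := ?_ }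
  · -- transitions: naturality of `e` and `Sc.map_pts`
    intro K K' f z a
    change Sc.pts K' (AlgPoints.map (eK K').hom (AlgPoints.baseChangeEquiv τ (M.obj K')
      (AlgPoints.map (M.map f) ((pts K).symm (ShimuraSet.mk L H τ T hT K.1.1 z a))))) = _
    have h1 : AlgPoints.baseChangeEquiv τ (M.obj K')
          (AlgPoints.map (M.map f) ((pts K).symm (ShimuraSet.mk L H τ T hT K.1.1 z a))) =
        AlgPoints.map ((Literature.AlgebraicGeometry.Motives.baseChangeHom τ).map (M.map f))
          (AlgPoints.baseChangeEquiv τ (M.obj K) ((pts K).symm (ShimuraSet.mk L H τ T hT K.1.1 z a))) := by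
      apply (AlgPoints.baseChangeEquiv τ (M.obj K')).symm.injective
      rw [Equiv.symm_apply_apply, baseChangeEquiv_symm_map₃, Equiv.symm_apply_apply]
    have h2 : ∀ Q : ComplexPoints ((Literature.AlgebraicGeometry.Motives.baseChangeHom τ).obj (M.obj K)),
        AlgPoints.map (eK K').hom (AlgPoints.map ((Literature.AlgebraicGeometry.Motives.baseChangeHom τ).map (M.map f)) Q) =
          AlgPoints.map (Sc.Mc.map f) (AlgPoints.map (eK K).hom Q) := fun Q => by
      rw [← AlgPoints.map_comp_apply, heK_nat K K' f, AlgPoints.map_comp_apply]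
    rw [h1, h2, hpts', hinvhom]
    exact Sc.map_pts K K' f z a
  · -- holomorphy, transported along `e⁻¹`
    intro K a
    obtain ⟨u, hu1, hu2, hu3⟩ := Sc.hol K a
    refine ⟨fun v => AlgPoints.map (eK K).inv (u v), fun x => ?_, fun v hv c hc => ?_, fun U f => ?_⟩
    · change AlgPoints.map (eK K).inv (u ((T : Matrix (Fin 3) (Fin 3) ℂ) *ᵥ BallModel.lift x)) = _
      rw [hu1 x, hpts']
    · change AlgPoints.map (eK K).inv (u (c • v)) = AlgPoints.map (eK K).inv (u v)
      rw [hu2 v hv c hc]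
    · have hU : IsAffineOpen ((eK K).inv.left ⁻¹ᵁ (↑U : ((Literature.AlgebraicGeometry.Motives.baseChangeHom τ).obj (M.obj K)).left.Opens)) :=
        U.2.preimage_of_isIso (eK K).inv.left
      have hd := hu3 ⟨_, hU⟩ ((eK K).inv.left.app (↑U : ((Literature.AlgebraicGeometry.Motives.baseChangeHom τ).obj (M.obj K)).left.Opens) f)
      refine (hd.congr ?_).mono ?_
      · rintro v -
        exact AlgPoints.evalOrZero_map (eK K).inv _ f (u v)
      · rintro v ⟨hv, hvU⟩
        exact ⟨hv, hvU⟩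
  · -- pieces: the cofan of `Sc` composed with `e⁻¹`
    intro K
    obtain ⟨g, hg, X, ι, hcol, B, hB⟩ := Sc.pieces K
    refine ⟨g, hg, X, fun q => ι q ≫ (eK K).inv, ?_, B, fun q => ⟨(hB q).1, (hB q).2.1, fun x => ?_⟩⟩
    · exact IsColimit.ofIsoColimit hcol (Cofan.ext (eK K).symm fun q => rfl)
    · rw [AlgPoints.map_comp_apply, (hB q).2.2 x, hpts']
  · -- reciprocity: the hypothesis, read through `pts`
    intro K σ s hσ v₃ x hx d hd a
    rw [hpts, hpts]
    exact recip K σ s hσ v₃ x hx d hd a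



/-- The models of `RecordSystem.ofDescent` are the given `M` (by `rfl`). [cite: Deligne1979ShimuraVarieties, 2.2.5] -/
theorem RecordSystem.ofDescent_M (Sc : ComplexRecordSystem L H τ T hT K₀) (M : C5.SmallLevel K₀ ⥤ SchemeOver L)
    (hsm : ∀ K : C5.SmallLevel K₀, AlgebraicGeometry.SmoothOfRelativeDimension 2 (M.obj K).hom)
    (hpr : ∀ K : C5.SmallLevel K₀, IsProjectiveOver (M.obj K))
    (e : (M ⋙ Literature.AlgebraicGeometry.Motives.baseChangeHom τ) ≅ Sc.Mc)
    (recip : letI : Algebra L ℂ := τ.toAlgebra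
      ∀ (K : C5.SmallLevel K₀) (σ : ℂ ≃ₐ[L] ℂ) (s : (FiniteAdeleRing (𝓞 L) L)ˣ),
        IsArtinCorrespondent L τ s σ.toRingEquiv →
        ∀ (v₃ : Fin 3 → L) (x : Ball), IsLinePoint L τ T v₃ x →
          ∀ d : finAdelic (↥(maximalRealSubfield L)) L (IsCMField.complexConj L) 3 H,
            IsDiagTwist L H v₃ (recipFactor L s) d →
            ∀ a : finAdelic (↥(maximalRealSubfield L)) L (IsCMField.complexConj L) 3 H,
              σ • (AlgPoints.baseChangeEquiv τ (M.obj K)).symm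
                  (AlgPoints.map (e.inv.app K) ((Sc.pts K).symm (ShimuraSet.mk L H τ T hT K.1.1 x a))) =
                (AlgPoints.baseChangeEquiv τ (M.obj K)).symm
                  (AlgPoints.map (e.inv.app K) ((Sc.pts K).symm (ShimuraSet.mk L H τ T hT K.1.1 x (d * a))))) :
    (RecordSystem.ofDescent Sc M hsm hpr e recip).M = M :=
  rfl

/-- **The points of `RecordSystem.ofDescent`** (by `rfl`): `(S.pts K)⁻¹ P = (M_K(ℂ) ≃ (M_K)_τ(ℂ))⁻¹ (e_K⁻¹ (Sc.pts_K⁻¹ P))`.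
[cite: Deligne1979ShimuraVarieties, 2.2.5] [cite: Milne2005ShimuraVarieties, Def. 12.10 p. 115] -/
theorem RecordSystem.ofDescent_pts_symm (Sc : ComplexRecordSystem L H τ T hT K₀) (M : C5.SmallLevel K₀ ⥤ SchemeOver L)
    (hsm : ∀ K : C5.SmallLevel K₀, AlgebraicGeometry.SmoothOfRelativeDimension 2 (M.obj K).hom)
    (hpr : ∀ K : C5.SmallLevel K₀, IsProjectiveOver (M.obj K))
    (e : (M ⋙ Literature.AlgebraicGeometry.Motives.baseChangeHom τ) ≅ Sc.Mc)
    (recip : letI : Algebra L ℂ := τ.toAlgebra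
      ∀ (K : C5.SmallLevel K₀) (σ : ℂ ≃ₐ[L] ℂ) (s : (FiniteAdeleRing (𝓞 L) L)ˣ),
        IsArtinCorrespondent L τ s σ.toRingEquiv →
        ∀ (v₃ : Fin 3 → L) (x : Ball), IsLinePoint L τ T v₃ x →
          ∀ d : finAdelic (↥(maximalRealSubfield L)) L (IsCMField.complexConj L) 3 H,
            IsDiagTwist L H v₃ (recipFactor L s) d →
            ∀ a : finAdelic (↥(maximalRealSubfield L)) L (IsCMField.complexConj L) 3 H,
              σ • (AlgPoints.baseChangeEquiv τ (M.obj K)).symm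
                  (AlgPoints.map (e.inv.app K) ((Sc.pts K).symm (ShimuraSet.mk L H τ T hT K.1.1 x a))) =
                (AlgPoints.baseChangeEquiv τ (M.obj K)).symm
                  (AlgPoints.map (e.inv.app K) ((Sc.pts K).symm (ShimuraSet.mk L H τ T hT K.1.1 x (d * a)))))
    (K : C5.SmallLevel K₀) (P : ShimuraSet L H τ T hT K.1.1) :
    letI : Algebra L ℂ := τ.toAlgebra
    ((RecordSystem.ofDescent Sc M hsm hpr e recip).pts K).symm P =
      (AlgPoints.baseChangeEquiv τ (M.obj K)).symm (AlgPoints.map (e.inv.app K) ((Sc.pts K).symm P)) :=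
  rfl

/-! ### B2 and the change of frame AS DATA, with their point formulas -/

/-- **B2 as data**: the record system of `(H, τ̄ = conj ∘ τ, T̄ = conjFrame T)` with the SAME models `R.M` — `RecordSystem.ofDescent` at
`(alongConj R_ℂ, R.M, modelsAlongConjIso R.M τ, recip_alongConj R)` (the witness behind ✔ `RecordSystem.exists_alongConj`).
[cite: Deligne1979ShimuraVarieties, 2.2.5] [cite: Milne2005ShimuraVarieties, §12 and Def. 12.8 (62) p. 114] -/
def RecordSystem.alongConj (R : RecordSystem L H τ T hT K₀) :
    RecordSystem L H ((starRingEnd ℂ).comp τ) (conjFrame T) (formCongr_conjFrame_starRingEnd_comp H τ T hT) K₀ :=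
  RecordSystem.ofDescent (ComplexRecordSystem.alongConj R.complexRecordSystem) R.M R.smooth R.projective
    (modelsAlongConjIso R.M τ) (recip_alongConj R)

/-- The models of `R.alongConj` are `R.M` (by `rfl`). [cite: Deligne1979ShimuraVarieties, 2.2.5] -/
theorem RecordSystem.alongConj_M (R : RecordSystem L H τ T hT K₀) : (RecordSystem.alongConj R).M = R.M :=
  rfl

/-- **The points of `R.alongConj`**: `(R.alongConj.pts K)⁻¹ [x, aK]_{τ̄} = Spec(conj) ≫ (R.pts K)⁻¹ [x̄, aK]` — the twist (wb-1 `D2Bridge.twist`)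
of the record's point at the conjugate ball point. [cite: Deligne1979ShimuraVarieties, 2.2.5] [cite: Milne2005ShimuraVarieties, Lemma 5.13 p. 57 and §12] -/
theorem RecordSystem.alongConj_pts_symm_mk (R : RecordSystem L H τ T hT K₀) (K : C5.SmallLevel K₀) (x : Ball)
    (a : finAdelic (↥(maximalRealSubfield L)) L (IsCMField.complexConj L) 3 H) :
    letI : Algebra L ℂ := ((starRingEnd ℂ).comp τ).toAlgebra
    ((RecordSystem.alongConj R).pts K).symm
        (ShimuraSet.mk L H ((starRingEnd ℂ).comp τ) (conjFrame T) (formCongr_conjFrame_starRingEnd_comp H τ T hT) K.1.1 x a) =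
      twist (conjEmb_eq τ) (letI : Algebra L ℂ := τ.toAlgebra; (R.pts K).symm (ShimuraSet.mk L H τ T hT K.1.1 (conjBall x) a)) := by
  letI : Algebra L ℂ := ((starRingEnd ℂ).comp τ).toAlgebra
  unfold RecordSystem.alongConj
  rw [RecordSystem.ofDescent_pts_symm, modelsAlongConjIso_inv_app, ComplexRecordSystem.alongConj_pts_symm_mk_record]
  exact twist_conjEmb_eq_baseChangeEquiv_symm τ (R.M.obj K) _

/-- **The change of frame as data**: the record system of `(H, τ, T·u)`, `u ∈ U(2,1)`, with the SAME models `R.M` — `RecordSystem.ofDescent` at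
`(frameChange R_ℂ u, R.M, Iso.refl, recip_frameChange R u)` (the witness behind ✔ `RecordSystem.exists_frameChange`).
[cite: Deligne1979ShimuraVarieties, 2.2.5] [cite: Milne2005ShimuraVarieties, §12] -/
def RecordSystem.frameChange (R : RecordSystem L H τ T hT K₀) (u : U21) :
    RecordSystem L H τ (T * (u : GL (Fin 3) ℂ)) (formCongr_mul_U21 L H τ T hT u) K₀ :=
  RecordSystem.ofDescent (ComplexRecordSystem.frameChange R.complexRecordSystem u) R.M R.smooth R.projective
    (Iso.refl _) (recip_frameChange R u)

/-- The models of `R.frameChange u` are `R.M` (by `rfl`). [cite: Deligne1979ShimuraVarieties, 2.2.5] -/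
theorem RecordSystem.frameChange_M (R : RecordSystem L H τ T hT K₀) (u : U21) : (RecordSystem.frameChange R u).M = R.M :=
  rfl

/-- **The points of `R.frameChange u`**: `((R.frameChange u).pts K)⁻¹ [y, aK]_{T·u} = (R.pts K)⁻¹ [u • y, aK]_T`.
[cite: Deligne1979ShimuraVarieties, 2.2.5] [cite: Milne2005ShimuraVarieties, Lemma 5.13 p. 57] -/
theorem RecordSystem.frameChange_pts_symm_mk (R : RecordSystem L H τ T hT K₀) (u : U21) (K : C5.SmallLevel K₀) (y : Ball)
    (a : finAdelic (↥(maximalRealSubfield L)) L (IsCMField.complexConj L) 3 H) :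
    letI : Algebra L ℂ := τ.toAlgebra
    ((RecordSystem.frameChange R u).pts K).symm
        (ShimuraSet.mk L H τ (T * (u : GL (Fin 3) ℂ)) (formCongr_mul_U21 L H τ T hT u) K.1.1 y a) =
      (R.pts K).symm (ShimuraSet.mk L H τ T hT K.1.1 (u • y) a) := by
  letI : Algebra L ℂ := τ.toAlgebra
  have hid : ∀ P : ComplexPoints ((Literature.AlgebraicGeometry.Motives.baseChangeHom τ).obj (R.M.obj K)),
      AlgPoints.map ((Iso.refl (R.M ⋙ Literature.AlgebraicGeometry.Motives.baseChangeHom τ)).inv.app K) P = P := fun P => by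
    apply Over.OverMorphism.ext
    rw [AlgPoints.map_apply, Over.comp_left, Iso.refl_inv, NatTrans.id_app, Over.id_left]
    exact Category.comp_id _
  unfold RecordSystem.frameChange
  rw [RecordSystem.ofDescent_pts_symm, ComplexRecordSystem.frameChange_pts_symm_mk_record]
  exact (congrArg (AlgPoints.baseChangeEquiv τ (R.M.obj K)).symm (hid _)).trans
    ((AlgPoints.baseChangeEquiv τ (R.M.obj K)).symm_apply_apply _)


end DescentPts

end Summit.HodgeConjecture.CorCM.Model.RecordSystemConj

end
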